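import Literature.Dynamics.NBody.PlanarCCRigidity
import Literature.Dynamics.NBody.JensenLeykin2025Roberts
import Mathlib.Tactic
import HarnessLib

/-!
# The torus target ON the exceptional family `E32 = {(a,a,b,b,c)}` and what it decides

[AlbouyKaloshin2012, Theorem 2 p. 537] leaves generic finiteness of planar five-body central
configurations open on the codimension-2 family `E32`; [JensenLeykin2025, §4.2 p. 6] report that their
tropical computation specialised to `(a, a, b, b, c)` "fails to confirm" finiteness.  The natural TARGET
of a torus / tropical certificate computed inside the family is

  `E32TorusTarget` : ∃ nonzero `P ∈ ℚ[a,b,c]`, for every char-0 field `K` and `(a,b,c) ∈ K³` with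
  `P(a,b,c) ≠ 0`, the Jensen–Leykin torus system at masses `(a,a,b,b,c)` is finite

(this is literally the statement typed by the cell's staging file, over the landed `jlNormalizedCCs`).
This file proves, in the kernel:

* `e32_generic_positiveCC_finite_of_torusTarget` : `E32TorusTarget` ⇒ generic-ON-`E32` finiteness of
  POSITIVE NORMALIZED central configurations in the sense of [AlbouyKaloshin2012, Definition 1]:
  the same `P` works for all real `(a,b,c)` with `2a + 2b + c > 0`, `P(a,b,c) ≠ 0`
  (dictionary + transfer + rigidity: `positiveNormalizedCCs_finite_of_jlFinite`);
* `e32TorusTarget_poly_vanishes_on_robertsLine` : every `P` witnessing `E32TorusTarget` vanishes at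
  `(4s, 4s, s)`, `s ≠ 0` — the torus system is infinite on the Roberts line
  (`jlNormalizedCCs_44441_infinite` + mass scaling), so NO torus certificate inside `E32` can cover the
  points `(4s,4s,4s,4s,s)`; finiteness of positive CCs there stays open.
-/

namespace Literature.Dynamics.NBody

open Finset

/-- Masses on the exceptional family `E32`. [cite: AlbouyKaloshin2012, Theorem 2 p. 537] -/
def massesE32 {K : Type*} (a b c : K) : Fin 5 → K := ![a, a, b, b, c]

/-- The torus target on `E32` (generic finiteness of the Jensen–Leykin torus system inside the family,
genericity measured by a nonzero `P ∈ ℚ[a,b,c]`). A TARGET of certificates, not a cited fact.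
[cite: JensenLeykin2025, §4.2 p. 6] -/
def E32TorusTarget : Prop :=
  ∃ P : MvPolynomial (Fin 3) ℚ, P ≠ 0 ∧
    ∀ (K : Type) [Field K] [CharZero K] (a b c : K),
      MvPolynomial.aeval ![a, b, c] P ≠ 0 → (jlNormalizedCCs K (massesE32 a b c)).Finite

/-- Total mass on `E32`. [folklore] -/
theorem massesE32_sum {K : Type*} [Field K] (a b c : K) :
    ∑ k, massesE32 a b c k = 2 * a + 2 * b + c := by
  simp [massesE32, Fin.sum_univ_five]; ring

/-- THE TORUS TARGET ON `E32` DECIDES AK-FINITENESS GENERICALLY ON `E32`: with the same exceptional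
polynomial `P`, every real `(a,b,c)` with positive total mass `2a+2b+c > 0` and `P(a,b,c) ≠ 0` has only
finitely many positive normalized central configurations with masses `(a,a,b,b,c)`.
[cite: AlbouyKaloshin2012, Definition 1 p. 536; JensenLeykin2025, §2.4 p. 3 — derived in-tree] -/
theorem e32_generic_positiveCC_finite_of_torusTarget (h : E32TorusTarget) :
    ∃ P : MvPolynomial (Fin 3) ℚ, P ≠ 0 ∧ ∀ a b c : ℝ, 0 < 2 * a + 2 * b + c →
      MvPolynomial.aeval ![a, b, c] P ≠ 0 → (positiveNormalizedCCs (massesE32 a b c)).Finite := by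
  obtain ⟨P, hP0, hP⟩ := h
  refine ⟨P, hP0, fun a b c hM hPabc => ?_⟩
  have hM' : 0 < ∑ k, massesE32 a b c k := by rw [massesE32_sum]; exact hM
  exact positiveNormalizedCCs_finite_of_jlFinite _ hM' (by norm_num) (hP ℝ a b c hPabc)

/-- In particular for positive masses `a, b, c > 0` off `{P = 0}`.
[cite: AlbouyKaloshin2012, Definition 1 p. 536 — derived in-tree] -/
theorem e32_generic_positiveCC_finite_of_torusTarget_pos (h : E32TorusTarget) :
    ∃ P : MvPolynomial (Fin 3) ℚ, P ≠ 0 ∧ ∀ a b c : ℝ, 0 < a → 0 < b → 0 < c →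
      MvPolynomial.aeval ![a, b, c] P ≠ 0 → (positiveNormalizedCCs (massesE32 a b c)).Finite := by
  obtain ⟨P, hP0, hP⟩ := e32_generic_positiveCC_finite_of_torusTarget h
  exact ⟨P, hP0, fun a b c ha hb hc hne => hP a b c (by linarith) hne⟩

/-- The Roberts line inside `E32`: `massesE32 (4s) (4s) s = s • (4,4,4,4,1)`. [folklore] -/
theorem massesE32_robertsLine (s : ℝ) :
    massesE32 (4 * s) (4 * s) s = fun k => s * (![4, 4, 4, 4, 1] : Fin 5 → ℝ) k := by
  funext k; fin_cases k <;> simp [massesE32] <;> ring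

/-- NO TORUS CERTIFICATE INSIDE `E32` COVERS THE ROBERTS LINE: every polynomial witnessing
`E32TorusTarget` vanishes at `(4s, 4s, s)` for all real `s ≠ 0`, because the torus system at
`(4s,4s,4s,4s,s)` is infinite. [cite: JensenLeykin2025, §4.2 p. 6 — derived in-tree] -/
theorem e32TorusTarget_poly_vanishes_on_robertsLine (P : MvPolynomial (Fin 3) ℚ)
    (hP : ∀ (K : Type) [Field K] [CharZero K] (a b c : K),
      MvPolynomial.aeval ![a, b, c] P ≠ 0 → (jlNormalizedCCs K (massesE32 a b c)).Finite)
    (s : ℝ) (hs : s ≠ 0) :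
    MvPolynomial.aeval (![4 * s, 4 * s, s] : Fin 3 → ℝ) P = 0 := by
  by_contra h
  have hfin := hP ℝ (4 * s) (4 * s) s h
  rw [massesE32_robertsLine s, jlNormalizedCCs_smul_masses s hs] at hfin
  exact jlNormalizedCCs_44441_infinite hfin

/-- In particular at `(a,b,c) = (4,4,1)`, i.e. masses `(4,4,4,4,1)`.
[cite: JensenLeykin2025, §4.2 p. 6 — derived in-tree] -/
theorem e32TorusTarget_poly_vanishes_at_441 (P : MvPolynomial (Fin 3) ℚ)
    (hP : ∀ (K : Type) [Field K] [CharZero K] (a b c : K),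
      MvPolynomial.aeval ![a, b, c] P ≠ 0 → (jlNormalizedCCs K (massesE32 a b c)).Finite) :
    MvPolynomial.aeval (![4, 4, 1] : Fin 3 → ℝ) P = 0 := by
  have h := e32TorusTarget_poly_vanishes_on_robertsLine P hP 1 one_ne_zero
  simpa using h

end Literature.Dynamics.NBody
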